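import Mathlib
import Literature.NumberTheory.Irrationality.LaiSprangZudilin2026.Telescoping
import Literature.NumberTheory.Irrationality.LaiSprangZudilin2026.SecondSolution
import Literature.NumberTheory.Irrationality.RivoalZudilin2020.DenominatorsBricks
import Literature.NumberTheory.Transcendental.PartialFractions
import HarnessLib

/-!
# Lai–Sprang–Zudilin 2026, §§3–4: the partial fractions of `R_n(t)`, the coefficients `ρ_{n,0}`, `ρ_{n,3}`
# as printed, and Lemma 4.2 (a) PROVED

Topic `Literature/NumberTheory/Irrationality/LaiSprangZudilin2026`.  Source: L. Lai, J. Sprang, W. Zudilin,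
*A note on the irrationality of `ζ₂(5)`*, IMRN **2026**:16, rnag180 = arXiv:2505.05005 [LaiSprangZudilin2026]
(held text `paper:arxiv-2505.05005`, §3 = pp. 5–6, §4 = p. 7 of the text, read on the page).  Proofs-and-
definitions companion of `Telescoping.lean` (`R`, `T`, `lemma41`) and `SecondSolution.lean` (`recSol`, `rho0`,
`rho3`): everything here is PROVED, no named fact is introduced.

## Source, as printed

* (def_rik) «`R_n(t) =: Σ_{i=1}^{4} Σ_{k=0}^{n} r_{n,i,k}/(t+k)^i`, with the coefficients `r_{n,i,k} ∈ ℚ` uniquely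
  determined by `R_n(t)`»; Lemma 3.3 (def_rho_0), (def_rho_3):
  «`ρ_{n,0} = −Σ_{i=1}^{4} Σ_{k=0}^{n} Σ_{ℓ=1}^{k} i(i+1) r_{n,i,k}/(ℓ−½)^{i+2} ∈ ℚ`, `ρ_{n,3} = 384 Σ_{k=0}^{n} r_{n,3,k} ∈ ℚ`.
  The convention here and in what follows is that the empty sum (when `k = 0`) is understood as `0`.»
* **Lemma 4.2 (a).** «For each `i ∈ {0,3}`, the sequence `(ρ_{n,i})_{n≥0}` satisfies the three-term relation
  (eq:rec).»  Printed proof: `T_n(t) =: c_n + Σ_{i,k} a_{n,i,k}/(t+k)^i`; «By Equations (4.1), (def_rik) and the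
  uniqueness of partial-fraction decomposition … (4.2)
  `(n+1)⁵ r_{n+1,i,k} − 32(2n+1)(8n⁴+16n³+20n²+12n+3) r_{n,i,k} + 2¹⁶n⁵ r_{n−1,i,k} = a_{n,i,k−1} − a_{n,i,k}`,
  where all the coefficients outside the eligible range vanish»; summing (4.2) over `k` for `i = 3` gives the
  recursion for `ρ_{n,3}`; for `ρ_{n,0}` the paper passes through the 2-adic integral `S_n` and `−T_n″(½) = 0`.
* Proof of Lemma 4.2 (b): «`ρ_{0,0} = 0`, `ρ_{0,3} = 768`, `ρ_{1,0} = −1024`, `ρ_{1,3} = 73728`».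

## What is formalised (all PROVED)

* `divDeriv_eq_coeff_of_pfEval` — a GENERIC form of the identification step used four times in the tree
  (`ZudilinCoefficients.divDeriv_G_eq_coeff`, `Zudilin2004.Lemma19Coefficients`, `RivoalZudilin2020.{PartialFractionsProofs,
  DenominatorsTransfer}`): if `f = q + Σ_{i∈T} Σ_{s≤A} c_{i,s}(t+i)^{−s}` off the poles with `q` smooth at `−m`, and
  `g` is a function continuous at `−m` that agrees with `f·(t+m)^A` off the poles, then `𝒟_a g(−m) = c_{m,A−a}`
  (`a < A`).  This is «the coefficients `r_{n,i,k}` uniquely determined by `R_n(t)`» in usable form.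
* `Rreg n k` — the BRICK FORM `(2t+n)·(2^{2n}(t+½)_n/n!)⁴·(n!(t+k)/(t)_{n+1})⁴` of `R_n(t)(t+k)⁴` (tree bricks
  `RivoalZudilin2020.halfBrick 0 n`, `RivoalZudilin2020.Greg n k`), regular at `−k`; `Rreg_eq`; `Rreg_isDInt`
  (`d_n^j 𝒟_j(R_n(t)(t+k)⁴)(−k) ∈ ℤ`, the input of Lemma 5.1).
* `coeffR n i k := 𝒟_{4−i}(Rreg n k)(−k)` = `r_{n,i,k}` (def_rik); `R_eq_sum_coeffR` (the expansion (def_rik) off the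
  poles); `coeffR_eq_zero_of_lt` (`r_{n,i,k} = 0` for `k > n`); the values of `r_{0,i,k}`, `r_{1,i,k}`.
* `pfRho3 n := 384 Σ_k r_{n,3,k}` (def_rho_3) and `pfRho0 n := −Σ_k Σ_i Σ_{ℓ=1}^{k} i(i+1) r_{n,i,k}/(ℓ−½)^{i+2}`
  (def_rho_0); `pfRho3_zero/one`, `pfRho0_zero/one` (the four printed initial values).
* `Treg n k`, `coeffT n i k` (= `a_{n,i,k}`) for the certificate `T_n`; (4.2) = `coeff_recurrence` (from the tree's
  `lemma41` by taking divided derivatives of germs — no appeal to uniqueness is needed); `T''_n(½) = 0` in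
  coefficient form (`sum_coeffT_half_eq_zero`, from the factor `(t−½)⁴` of `T_n`); **Lemma 4.2 (a)**:
  `pfRho3_rec`, `pfRho0_rec` — the second by the ALGEBRAIC identity
  `Σ_k Σ_i i(i+1)H_{i+2}(k)(a_{n,i,k−1} − a_{n,i,k}) = Σ_{k,i} i(i+1)a_{n,i,k}/(k+½)^{i+2} = T_n″(½) = 0`
  (`H_s(k) = Σ_{ℓ≤k}(ℓ−½)^{−s}`), which replaces the paper's detour through the Volkenborn integral `S_n`.
* **The bridge to `SecondSolution.lean`**: `pfRho3_eq_rho3`, `pfRho0_eq_rho0` — the printed partial-fraction sums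
  ARE the recurrence-defined `rho3 = 768·recSol 1 96`, `rho0 = recSol 0 (−1024)` (same recursion, same two initial
  values), so the typed facts `lemma51`, `lemma53` of that file speak about (def_rho_0)/(def_rho_3) as printed.

Not covered here: §5 (the arithmetic Lemmas 5.1, 5.3: see `ArithmeticLemmaProofs.lean`), the 2-adic `S_n`.
-/

noncomputable section

open Finset Filter Topology Polynomial
open Literature.Analysis.Calculus
open Literature.NumberTheory.Transcendental
open Literature.NumberTheory.Irrationality.RivoalZudilin2020 (halfBrick Greg halfBrick_isDInt Greg_isDInt)
open scoped Nat

namespace Literature.NumberTheory.Irrationality.LaiSprangZudilin2026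

/-! ## Identification of partial-fraction coefficients with divided derivatives (generic) -/

/-- Off `−m`, a punctured neighbourhood of `−m` avoids all the poles `−i`, `i ∈ T`. [folklore] -/
private theorem eventually_nhdsNE_forall_add_ne_zero (T : Finset ℕ) (m : ℕ) :
    ∀ᶠ t : ℚ in 𝓝[≠] (-(m : ℚ)), ∀ i ∈ T, t + i ≠ 0 := by
  rw [eventually_all_finset]
  intro i _
  by_cases him : i = m
  · subst him
    filter_upwards [self_mem_nhdsWithin] with t ht
    intro h
    exact ht (Set.mem_singleton_iff.2 (by linarith))
  · have hne : (-(m : ℚ)) + i ≠ 0 := by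
      rw [show (-(m : ℚ) + i) = ((i : ℤ) - (m : ℤ) : ℤ) by push_cast; ring]
      exact_mod_cast sub_ne_zero.2 (by exact_mod_cast him : (i : ℤ) ≠ m)
    have hc : ContinuousAt (fun t : ℚ => t + i) (-(m : ℚ)) := (continuous_id.add continuous_const).continuousAt
    exact mem_nhdsWithin_of_mem_nhds (hc.eventually_ne hne)

/-- **Identification of the coefficients of a partial-fraction expansion** («the coefficients `r_{n,i,k} ∈ ℚ`
uniquely determined by `R_n(t)`»): let `f = q + Σ_{i ∈ T} Σ_{s=1}^{A} c_{i,s} (t+i)^{−s}` off the poles `−i`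
(`i ∈ T`), with `q` smooth at `−m` (`m ∈ T`), and let `g` be continuous at `−m` and equal to `f(t)(t+m)^A` off the
poles.  Then `𝒟_a g(−m) = c_{m,A−a}` for every `a < A`. [cite: LaiSprangZudilin2026, §3 (def_rik)] -/
theorem divDeriv_eq_coeff_of_pfEval {T : Finset ℕ} {A : ℕ} {f g q : ℚ → ℚ} {c : ℕ → ℕ → ℚ} {m : ℕ}
    (hm : m ∈ T) (hq : ContDiffAt ℚ (⊤ : ℕ∞) q (-(m : ℚ)))
    (hf : ∀ t : ℚ, (∀ i ∈ T, t + i ≠ 0) → f t = q t + pfEval T (fun _ => A) c t)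
    (hg : ContinuousAt g (-(m : ℚ)))
    (hfg : ∀ t : ℚ, (∀ i ∈ T, t + i ≠ 0) → g t = f t * (t + m) ^ A)
    {a : ℕ} (ha : a < A) :
    divDeriv a g (-(m : ℚ)) = c m (A - a) := by
  -- the regular part `H` and the candidate germ `F`
  set H : ℚ → ℚ := fun t => ∑ i ∈ T.erase m, ∑ s ∈ Icc 1 A, c i s * ((t + i) ^ s)⁻¹ with hH
  set F : ℚ → ℚ := fun t => ∑ s ∈ Icc 1 A, c m s * (t - (-(m : ℚ))) ^ (A - s)
    + (t - (-(m : ℚ))) ^ A * (q t + H t) with hF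
  have hHs : ContDiffAt ℚ (⊤ : ℕ∞) H (-(m : ℚ)) := by
    refine ContDiffAt.sum fun i hi => ContDiffAt.sum fun s _ => contDiffAt_const.mul ?_
    have him : i ≠ m := (mem_erase.1 hi).1
    refine ((contDiffAt_id.add contDiffAt_const).pow s).inv ?_
    have : (-(m : ℚ) + i) ≠ 0 := by
      rw [show (-(m : ℚ) + i) = ((i : ℤ) - (m : ℤ) : ℤ) by push_cast; ring]
      exact_mod_cast sub_ne_zero.2 (by exact_mod_cast him : (i : ℤ) ≠ m)
    simpa using pow_ne_zero s this
  have hqH : ContDiffAt ℚ (⊤ : ℕ∞) (fun t => q t + H t) (-(m : ℚ)) := hq.add hHs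
  have hterm : ∀ s ∈ Icc 1 A, ContDiffAt ℚ (⊤ : ℕ∞)
      (fun t : ℚ => c m s * (t - (-(m : ℚ))) ^ (A - s)) (-(m : ℚ)) := fun s _ =>
    contDiffAt_const.mul (contDiffAt_sub_pow _ _ _)
  have hFs : ContDiffAt ℚ (⊤ : ℕ∞) F (-(m : ℚ)) :=
    (ContDiffAt.sum fun s hs => hterm s hs).add ((contDiffAt_sub_pow _ _ _).mul hqH)
  -- `g = F` near `-m`
  have hGF : g =ᶠ[𝓝 (-(m : ℚ))] F := by
    refine eventuallyEq_of_nhdsNE hg hFs.continuousAt ?_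
    filter_upwards [eventually_nhdsNE_forall_add_ne_zero T m] with t ht
    have htm : t + m ≠ 0 := ht m hm
    rw [hfg t ht, hf t ht, pfEval, ← add_sum_erase _ _ hm, hF, hH]
    simp only [sub_neg_eq_add]
    have e1 : ∑ s ∈ Icc 1 A, c m s * ((t + m) ^ s)⁻¹ * (t + m) ^ A
        = ∑ s ∈ Icc 1 A, c m s * (t + m) ^ (A - s) := by
      refine sum_congr rfl fun s hs => ?_
      have hs' := (mem_Icc.1 hs).2
      have hpow : (t + m) ^ A = (t + m) ^ s * (t + m) ^ (A - s) := by
        rw [← pow_add]; congr 1; omega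
      rw [hpow, mul_assoc, ← mul_assoc (((t + m) ^ s)⁻¹), inv_mul_cancel₀ (pow_ne_zero s htm), one_mul]
    rw [add_mul, add_mul, sum_mul, e1]
    ring
  rw [divDeriv_congr hGF, hF]
  have ha' : ContDiffAt ℚ a (fun t => (t - (-(m : ℚ))) ^ A * (q t + H t)) (-(m : ℚ)) :=
    ((contDiffAt_sub_pow _ _ _).mul hqH).of_le (mod_cast le_top)
  rw [divDeriv_fun_add ((ContDiffAt.sum fun s hs => hterm s hs).of_le (mod_cast le_top)) ha',
    divDeriv_sub_pow_mul (hqH.of_le (mod_cast le_top)) A, if_pos ha, add_zero,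
    divDeriv_sum fun s hs => (hterm s hs).of_le (mod_cast le_top)]
  simp_rw [divDeriv_const_mul, divDeriv_sub_pow]
  rw [sum_eq_single_of_mem (A - a) (mem_Icc.2 ⟨by omega, by omega⟩)]
  · rw [if_pos (by omega), mul_one]
  · intro s hs hsa
    rw [if_neg (by have := mem_Icc.1 hs; omega), mul_zero]

/-! ## The bricks: smoothness away from the poles -/

/-- The half-integer brick (a polynomial) is smooth everywhere. [folklore] -/
private theorem contDiffAt_halfBrick (c : ℤ) (n : ℕ) (x : ℚ) {N : WithTop ℕ∞} :
    ContDiffAt ℚ N (halfBrick c n) x := by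
  unfold halfBrick
  fun_prop

/-- `Greg n k = n!(t+k)/(t)_{n+1}` (regularised) is smooth at every `x` off the poles `−l`, `l ≤ n`, `l ≠ k`.
[folklore] -/
private theorem contDiffAt_Greg (n k : ℕ) {x : ℚ} (hx : ∀ l ∈ range (n + 1), l ≠ k → x + l ≠ 0) {N : WithTop ℕ∞} :
    ContDiffAt ℚ N (Greg n k) x := by
  unfold Greg recipBrickReg
  refine (contDiffAt_const.mul (contDiffAt_prod fun l hl => ?_)).mul ?_
  · have hl' := mem_filter.1 hl
    refine contDiffAt_inv_add_const ?_
    have hlk : l ≠ k := fun h => hl'.2 (by simp [h])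
    have := hx l hl'.1 hlk
    push_cast
    simpa using this
  · split_ifs
    · exact contDiffAt_const
    · fun_prop

/-- `Greg n k t = n! · (t+k) · ∏_{l ≤ n} (t+l)⁻¹` off `t = −k` (any `k`). [folklore] -/
private theorem Greg_eq_mul_prod_inv (n k : ℕ) {t : ℚ} (htk : t + k ≠ 0) :
    Greg n k t = (n ! : ℚ) * (t + k) * ∏ l ∈ range (n + 1), (t + l)⁻¹ := by
  unfold Greg
  rw [recipBrickReg_eq 0 (n + 1) (k : ℤ) (by exact_mod_cast htk), recipBrick, Nat.add_sub_cancel]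
  push_cast
  simp only [zero_add]
  ring

/-! ## `R_n(t)(t+k)⁴` in brick form and the coefficients `r_{n,i,k}` -/

/-- The BRICK FORM of `R_n(t)(t+k)⁴`, regular at `t = −k`:
`(2t+n) · (2^{2n}(t+½)_n/n!)⁴ · (n!(t+k)/(t)_{n+1})⁴`. [cite: LaiSprangZudilin2026, §5 (R_n = (2t+n)F(t)⁴G(t)⁴)] -/
def Rreg (n k : ℕ) (t : ℚ) : ℚ :=
  (2 * t + n) * halfBrick 0 n t ^ 4 * Greg n k t ^ 4

/-- Off the poles `0, −1, …, −n` and off `−k`: `Rreg n k t = R_n(t)·(t+k)⁴`.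
[cite: LaiSprangZudilin2026, Definition 3.1 and §5 (F, G)] -/
theorem Rreg_eq (n k : ℕ) {t : ℚ} (ht : ∀ j ∈ range (n + 1), t + j ≠ 0) (htk : t + k ≠ 0) :
    Rreg n k t = R n t * (t + k) ^ 4 := by
  have hprod : ∏ j ∈ range (n + 1), (t + j) ≠ 0 := prod_ne_zero_iff.2 ht
  have hfac : (n ! : ℚ) ≠ 0 := by exact_mod_cast Nat.factorial_ne_zero n
  unfold Rreg R halfBrick
  rw [Greg_eq_mul_prod_inv n k htk, prod_inv_distrib]
  have e : ∏ j ∈ range n, (t + (((0 : ℤ) : ℚ) + 1 / 2 + j)) = ∏ j ∈ range n, (t + 1 / 2 + j) :=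
    prod_congr rfl fun j _ => by push_cast; ring
  rw [e]
  field_simp
  ring

/-- `Rreg n k` is smooth at every `x` off the poles other than `−k`. [cite: LaiSprangZudilin2026, §3 (def_rik), §5 (F, G)] -/
theorem contDiffAt_Rreg (n k : ℕ) {x : ℚ} (hx : ∀ l ∈ range (n + 1), l ≠ k → x + l ≠ 0)
    {N : WithTop ℕ∞} : ContDiffAt ℚ N (Rreg n k) x := by
  unfold Rreg
  exact ((by fun_prop : ContDiffAt ℚ N (fun t : ℚ => 2 * t + n) x).mul
    ((contDiffAt_halfBrick 0 n x).pow 4)).mul ((contDiffAt_Greg n k hx).pow 4)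

/-- `−k` is off the other poles. [folklore] -/
private theorem neg_add_ne_zero_of_ne {k l : ℕ} (h : l ≠ k) : (-(k : ℚ)) + l ≠ 0 := by
  rw [show (-(k : ℚ) + l) = ((l : ℤ) - (k : ℤ) : ℤ) by push_cast; ring]
  exact_mod_cast sub_ne_zero.2 (by exact_mod_cast h : (l : ℤ) ≠ k)

/-- `Rreg n k` is smooth at `−k` (the point where (def_rik)'s coefficients are read off). [cite: LaiSprangZudilin2026, §3 (def_rik)] -/
theorem contDiffAt_Rreg_neg (n k : ℕ) {N : WithTop ℕ∞} : ContDiffAt ℚ N (Rreg n k) (-(k : ℚ)) :=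
  contDiffAt_Rreg n k fun _ _ hl => neg_add_ne_zero_of_ne hl

/-- **`d_n^j · 𝒟_j(R_n(t)(t+k)⁴)(−k) ∈ ℤ`** for all `j` (`k ≤ n`): Leibniz over the bricks `2t+n`,
`2^{2n}(t+½)_n/n!` (an integer-valued polynomial) and `n!(t+k)/(t)_{n+1}` ([Zudilin2004, Lemma 16]).  This is the
«somewhat standard argument based on their properties (see [Lai2025+b] and [Zud2004])» of §5, giving
`d_n^{4−i} r_{n,i,k} ∈ ℤ`. [cite: LaiSprangZudilin2026, §5 (before Lemma 5.1)] -/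
theorem Rreg_isDInt (n : ℕ) {k : ℕ} (hk : k ≤ n) (N : ℕ) :
    IsDInt (Nat.lcmUpto n) N (Rreg n k) (-(k : ℚ)) := by
  have hlin : IsDInt (Nat.lcmUpto n) N (fun t : ℚ => 2 * t + n) (-(k : ℚ)) := by
    have := IsDInt.linear (Nat.lcmUpto n) N 2 (n : ℤ) (-(k : ℤ))
    simpa using this
  have hF : IsDInt (Nat.lcmUpto n) N (halfBrick 0 n) (-(k : ℚ)) := by
    simpa using halfBrick_isDInt 0 n (-(k : ℤ)) N
  exact (hlin.mul (hF.pow 4)).mul ((Greg_isDInt n hk N).pow 4)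

/-- The coefficient `r_{n,i,k}` of (def_rik), DEFINED as the Taylor coefficient
`𝒟_{4−i}(R_n(t)(t+k)⁴)|_{t=−k}` of the brick form (and by the same formula for every `k`; it vanishes for `k > n`,
`coeffR_eq_zero_of_lt`). [cite: LaiSprangZudilin2026, §3 (def_rik)] -/
def coeffR (n i k : ℕ) : ℚ := divDeriv (4 - i) (Rreg n k) (-(k : ℚ))

/-- `d_n^{4−i} · r_{n,i,k} ∈ ℤ` (`k ≤ n`, `i ≤ 4`). [cite: LaiSprangZudilin2026, §5 (proof of Lemma 5.1)] -/
theorem exists_int_lcm_pow_mul_coeffR (n : ℕ) {k : ℕ} (hk : k ≤ n) (i : ℕ) :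
    ∃ z : ℤ, (Nat.lcmUpto n : ℚ) ^ (4 - i) * coeffR n i k = z :=
  (Rreg_isDInt n hk (4 - i)).isInt (4 - i) le_rfl

/-! ### Existence of the expansion (def_rik) and identification of its coefficients -/

/-- The list of shifts `0, …, n`, each with multiplicity `4` (the linear factors of `(t)_{n+1}⁴`). [folklore] -/
def shifts4 (n : ℕ) : List ℕ :=
  (range (n + 1)).toList ++ (range (n + 1)).toList ++ (range (n + 1)).toList ++ (range (n + 1)).toList

/-- `|shifts4 n| = 4(n+1)`. [folklore] -/
private theorem length_shifts4 (n : ℕ) : (shifts4 n).length = 4 * (n + 1) := by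
  simp only [shifts4, List.length_append, Finset.length_toList, card_range]
  ring

/-- Every shift is `≤ n`. [folklore] -/
private theorem mem_range_of_mem_shifts4 {n i : ℕ} (hi : i ∈ shifts4 n) : i ∈ range (n + 1) := by
  simp only [shifts4, List.mem_append, Finset.mem_toList, or_self] at hi
  exact hi

/-- Every shift occurs at most `4` times. [folklore] -/
private theorem count_shifts4_le (n i : ℕ) : (shifts4 n).count i ≤ 4 := by
  have h1 : (range (n + 1)).toList.count i ≤ 1 :=
    List.nodup_iff_count_le_one.1 (Finset.nodup_toList _) i
  simp only [shifts4, List.count_append]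
  omega

/-- `∏_{i ∈ shifts4 n} (t+i)⁻¹ = (∏_{j ≤ n} (t+j))⁻⁴`. [folklore] -/
private theorem prod_shifts4 (n : ℕ) (t : ℚ) :
    ((shifts4 n).map fun i : ℕ => (t + (i : ℚ))⁻¹).prod = ((∏ j ∈ range (n + 1), (t + j)) ^ 4)⁻¹ := by
  have h1 : (((range (n + 1)).toList).map fun i : ℕ => (t + (i : ℚ))⁻¹).prod
      = (∏ j ∈ range (n + 1), (t + j))⁻¹ := by
    rw [Finset.prod_map_toList, prod_inv_distrib]
  simp only [shifts4, List.map_append, List.prod_append, h1]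
  ring

/-- A bound on the degree of `∏_{j<n}(X + u_j)`. [folklore] -/
private theorem natDegree_prod_X_add_C_le (n : ℕ) (u : ℕ → ℚ) :
    (∏ j ∈ range n, (X + C (u j) : ℚ[X])).natDegree ≤ n := by
  refine (natDegree_prod_le _ _).trans ?_
  refine (sum_le_sum (g := fun _ => 1) fun j _ => (natDegree_X_add_C _).le).trans ?_
  simp

/-- EXISTENCE of an expansion of `R_n` with poles of order `≤ 4` at `0, −1, …, −n` and no polynomial part:
the numerator `2^{8n}(2t+n)(t+½)_n⁴` has degree `4n+1 < 4(n+1)` (tree: `exists_pfEval_eq_eval_mul_prod_inv`).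
[cite: LaiSprangZudilin2026, §3 (deg R_n = −3 and (def_rik))] -/
theorem exists_R_eq_pfEval (n : ℕ) : ∃ c : ℕ → ℕ → ℚ, ∀ t : ℚ,
    (∀ i ∈ range (n + 1), t + i ≠ 0) → R n t = pfEval (range (n + 1)) (fun _ => 4) c t := by
  classical
  set P : ℚ[X] := C ((2 : ℚ) ^ (8 * n)) * (C 2 * X + C (n : ℚ)) *
      (∏ j ∈ range n, (X + C ((1 : ℚ) / 2 + j))) ^ 4 with hP
  have hdegP : P.natDegree ≤ 4 * n + 1 := by
    have h0 : (C ((2 : ℚ) ^ (8 * n)) * (C 2 * X + C (n : ℚ)) : ℚ[X]).natDegree ≤ 1 :=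
      (natDegree_C_mul_le _ _).trans natDegree_linear_le
    have h1 := (natDegree_pow_le (p := ∏ j ∈ range n, (X + C ((1 : ℚ) / 2 + j))) (n := 4)).trans
      (Nat.mul_le_mul_left 4 (natDegree_prod_X_add_C_le n fun j => (1 : ℚ) / 2 + j))
    refine (natDegree_mul_le.trans (add_le_add h0 h1)).trans ?_
    omega
  have hdeg : P.natDegree < (shifts4 n).length := by rw [length_shifts4]; omega
  obtain ⟨c, hc⟩ := exists_pfEval_eq_eval_mul_prod_inv (range (n + 1)) P (shifts4 n)
    (fun i hi => mem_range_of_mem_shifts4 hi) hdeg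
  have hPeval : ∀ t : ℚ, P.eval t = 2 ^ (8 * n) * (2 * t + n) * (∏ j ∈ range n, (t + 1 / 2 + j)) ^ 4 := by
    intro t
    rw [hP]
    simp only [eval_mul, eval_C, eval_add, eval_X, eval_pow, eval_prod]
    congr 2
    exact prod_congr rfl fun j _ => by ring
  have hR : ∀ t : ℚ, R n t = P.eval t * ((shifts4 n).map fun i : ℕ => (t + (i : ℚ))⁻¹).prod := by
    intro t
    rw [prod_shifts4, R, hPeval, div_eq_mul_inv]
  have hPF : IsPF (range (n + 1)) (fun i => (shifts4 n).count i) (R n) :=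
    ⟨c, fun t ht => (hR t).trans (hc t ht)⟩
  obtain ⟨c', hc'⟩ := hPF.mono fun i _ => count_shifts4_le n i
  exact ⟨c', hc'⟩

/-- For ANY expansion `R_n = Σ_{k ≤ n} Σ_{s ≤ 4} c_{k,s}(t+k)^{−s}` off the poles, `c_{k,i} = r_{n,i,k}`
(`k ≤ n`, `1 ≤ i ≤ 4`). [cite: LaiSprangZudilin2026, §3 (def_rik, uniqueness)] -/
theorem coeffR_eq_of_pfEval (n : ℕ) {c : ℕ → ℕ → ℚ}
    (hc : ∀ t : ℚ, (∀ i ∈ range (n + 1), t + i ≠ 0) → R n t = pfEval (range (n + 1)) (fun _ => 4) c t)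
    {k : ℕ} (hk : k ≤ n) {i : ℕ} (hi1 : 1 ≤ i) (hi4 : i ≤ 4) : coeffR n i k = c k i := by
  have hk' : k ∈ range (n + 1) := mem_range.2 (by omega)
  have h := divDeriv_eq_coeff_of_pfEval (T := range (n + 1)) (A := 4) (f := R n) (g := Rreg n k)
    (q := fun _ => 0) (c := c) hk' contDiffAt_const (fun t ht => by rw [hc t ht, zero_add])
    (contDiffAt_Rreg_neg n k (N := 0)).continuousAt
    (fun t ht => Rreg_eq n k ht (ht k hk')) (a := 4 - i) (by omega)
  rw [coeffR, h, show 4 - (4 - i) = i by omega]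

/-- **(def_rik)**: off the poles, `R_n(t) = Σ_{k=0}^{n} Σ_{i=1}^{4} r_{n,i,k} (t+k)^{−i}`.
[cite: LaiSprangZudilin2026, §3 (def_rik)] -/
theorem R_eq_sum_coeffR (n : ℕ) {t : ℚ} (ht : ∀ j ∈ range (n + 1), t + j ≠ 0) :
    R n t = ∑ k ∈ range (n + 1), ∑ i ∈ Icc 1 4, coeffR n i k * ((t + k) ^ i)⁻¹ := by
  obtain ⟨c, hc⟩ := exists_R_eq_pfEval n
  rw [hc t ht, pfEval]
  refine sum_congr rfl fun k hk => sum_congr rfl fun i hi => ?_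
  have hi' := mem_Icc.1 hi
  rw [coeffR_eq_of_pfEval n hc (by have := mem_range.1 hk; omega) hi'.1 hi'.2]

/-- For `k > n` the brick form is `(t+k)⁴` times a function smooth at `−k`. [folklore] -/
private theorem Rreg_eq_pow_mul_of_lt (n : ℕ) {k : ℕ} (hk : n < k) (t : ℚ) :
    Rreg n k t = (t - (-(k : ℚ))) ^ 4 *
      ((2 * t + n) * halfBrick 0 n t ^ 4 * (recipBrick 0 (n + 1) t) ^ 4) := by
  unfold Rreg Greg recipBrickReg recipBrick
  have hif : ¬ ((0 : ℤ) ≤ (k : ℤ) ∧ (k : ℤ) < 0 + ((n + 1 : ℕ) : ℤ)) := by push_cast; omega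
  rw [if_neg hif]
  have hall : (range (n + 1)).filter (fun l : ℕ => (0 : ℤ) + (l : ℤ) ≠ k) = range (n + 1) := by
    refine filter_true_of_mem fun l hl => ?_
    have := mem_range.1 hl
    omega
  rw [hall, sub_neg_eq_add]
  push_cast
  ring

/-- `r_{n,i,k} = 0` for `k > n` and `i ≥ 1` («all the coefficients outside the eligible range vanish»).
[cite: LaiSprangZudilin2026, §4 (proof of Lemma 4.2 (a))] -/
theorem coeffR_eq_zero_of_lt (n : ℕ) {k : ℕ} (hk : n < k) {i : ℕ} (hi : 1 ≤ i) : coeffR n i k = 0 := by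
  have hg : ContDiffAt ℚ ((4 - i : ℕ) : WithTop ℕ∞)
      (fun t : ℚ => (2 * t + n) * halfBrick 0 n t ^ 4 * (recipBrick 0 (n + 1) t) ^ 4) (-(k : ℚ)) := by
    refine (ContDiffAt.mul (by fun_prop) ((contDiffAt_halfBrick 0 n _).pow 4)).mul (ContDiffAt.pow ?_ 4)
    unfold recipBrick
    refine contDiffAt_const.mul (contDiffAt_prod fun l hl => contDiffAt_inv_add_const ?_)
    have := mem_range.1 hl
    push_cast
    simp only [zero_add]
    exact neg_add_ne_zero_of_ne (by omega)
  rw [coeffR, show Rreg n k = fun t => (t - (-(k : ℚ))) ^ 4 *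
      ((2 * t + n) * halfBrick 0 n t ^ 4 * (recipBrick 0 (n + 1) t) ^ 4) from
    funext (Rreg_eq_pow_mul_of_lt n hk), divDeriv_sub_pow_mul hg 4, if_pos (by omega)]

/-! ### The values at `n = 0` and `n = 1` -/

/-- `Σ_{s=1}^{4} f(s) = f(1)+f(2)+f(3)+f(4)`. [folklore] -/
private theorem sum_Icc_one_four (f : ℕ → ℚ) : ∑ s ∈ Icc 1 4, f s = f 1 + f 2 + f 3 + f 4 := by
  rw [show (Icc 1 4 : Finset ℕ) = {1, 2, 3, 4} by decide]
  simp [Finset.sum_insert, add_assoc]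

/-- `R_0(t) = 2t/t⁴ = 2/t³`: an explicit expansion of `R_0`. [cite: LaiSprangZudilin2026, Definition 3.1 (n = 0)] -/
theorem R_zero_eq_pfEval (t : ℚ) (ht : ∀ i ∈ range (0 + 1), t + i ≠ 0) :
    R 0 t = pfEval (range (0 + 1)) (fun _ => 4) (fun _ s => if s = 3 then 2 else 0) t := by
  have ht0 : t ≠ 0 := by simpa using ht 0 (by simp)
  rw [pfEval, zero_add, Finset.sum_range_one, sum_Icc_one_four, R]
  simp only [Nat.cast_zero, prod_range_zero, add_zero, mul_zero, pow_zero]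
  norm_num
  field_simp

/-- The expansion of `R_1(t) = 2⁸(2t+1)(t+½)⁴/(t⁴(t+1)⁴)`:
`16/t⁴ + 96/t³ + 160/t² − 16/(t+1)⁴ + 96/(t+1)³ − 160/(t+1)²` (coefficient table).
[cite: LaiSprangZudilin2026, Definition 3.1 (n = 1), proof of Lemma 4.2 (b)] -/
def coeffROne (k s : ℕ) : ℚ :=
  if k = 0 then (if s = 4 then 16 else if s = 3 then 96 else if s = 2 then 160 else 0)
  else (if s = 4 then -16 else if s = 3 then 96 else if s = 2 then -160 else 0)

/-- `R_1(t) = 16/t⁴ + 96/t³ + 160/t² − 16/(t+1)⁴ + 96/(t+1)³ − 160/(t+1)²`.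
[cite: LaiSprangZudilin2026, Definition 3.1 (n = 1)] -/
theorem R_one_eq_pfEval (t : ℚ) (ht : ∀ i ∈ range (1 + 1), t + i ≠ 0) :
    R 1 t = pfEval (range (1 + 1)) (fun _ => 4) coeffROne t := by
  have ht0 : t ≠ 0 := by simpa using ht 0 (by simp)
  have ht1 : t + 1 ≠ 0 := by simpa using ht 1 (by simp)
  rw [pfEval, Finset.sum_range_succ, Finset.sum_range_one, sum_Icc_one_four, sum_Icc_one_four, R]
  simp only [coeffROne, Finset.prod_range_succ, prod_range_zero]
  norm_num
  field_simp
  ring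

/-- `r_{0,i,0} = 2·[i = 3]`. [cite: LaiSprangZudilin2026, Definition 3.1 (n = 0)] -/
theorem coeffR_zero {i : ℕ} (hi1 : 1 ≤ i) (hi4 : i ≤ 4) : coeffR 0 i 0 = if i = 3 then 2 else 0 :=
  coeffR_eq_of_pfEval 0 (c := fun _ s => if s = 3 then 2 else 0) R_zero_eq_pfEval le_rfl hi1 hi4

/-- `r_{1,i,k}` from the table `coeffROne`. [cite: LaiSprangZudilin2026, Definition 3.1 (n = 1)] -/
theorem coeffR_one {k : ℕ} (hk : k ≤ 1) {i : ℕ} (hi1 : 1 ≤ i) (hi4 : i ≤ 4) : coeffR 1 i k = coeffROne k i :=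
  coeffR_eq_of_pfEval 1 R_one_eq_pfEval hk hi1 hi4

/-! ## `ρ_{n,3}` and `ρ_{n,0}` as printed -/

/-- **(def_rho_3)** `ρ_{n,3} = 384 Σ_{k=0}^{n} r_{n,3,k}`. [cite: LaiSprangZudilin2026, Lemma 3.3 (def_rho_3)] -/
def pfRho3 (n : ℕ) : ℚ := 384 * ∑ k ∈ range (n + 1), coeffR n 3 k

/-- **(def_rho_0)** `ρ_{n,0} = −Σ_{i=1}^{4} Σ_{k=0}^{n} Σ_{ℓ=1}^{k} i(i+1) r_{n,i,k}/(ℓ−½)^{i+2}` (empty inner sum for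
`k = 0`). [cite: LaiSprangZudilin2026, Lemma 3.3 (def_rho_0)] -/
def pfRho0 (n : ℕ) : ℚ :=
  -∑ i ∈ (Icc 1 4 : Finset ℕ), ∑ k ∈ range (n + 1), ∑ ℓ ∈ Icc 1 k,
    (i : ℚ) * ((i : ℚ) + 1) * coeffR n i k / (((ℓ : ℚ) - 1 / 2) ^ (i + 2))

/-- The finite half-integer sums `H_s(k) = Σ_{ℓ=1}^{k} (ℓ−½)^{−s}` (empty for `k = 0`).
[cite: LaiSprangZudilin2026, Lemma 3.3 (def_rho_0)] -/
def halfInvPowSum (s k : ℕ) : ℚ := ∑ ℓ ∈ Icc 1 k, (((ℓ : ℚ) - 1 / 2) ^ s)⁻¹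

/-- `H_s(0) = 0`. [cite: LaiSprangZudilin2026, Lemma 3.3 («the empty sum … is understood as 0»)] -/
@[simp] theorem halfInvPowSum_zero (s : ℕ) : halfInvPowSum s 0 = 0 := by
  simp [halfInvPowSum]

/-- `H_s(k+1) − H_s(k) = (k+½)^{−s}`. [cite: LaiSprangZudilin2026, Lemma 3.3 (def_rho_0)] -/
theorem halfInvPowSum_succ_sub (s k : ℕ) :
    halfInvPowSum s (k + 1) - halfInvPowSum s k = (((k : ℚ) + 1 / 2) ^ s)⁻¹ := by
  rw [halfInvPowSum, halfInvPowSum, Finset.sum_Icc_succ_top (by omega), add_sub_cancel_left]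
  push_cast
  ring

/-- `ρ_{n,0}` with the `ℓ`-sums collected: `ρ_{n,0} = −Σ_{k ≤ n} Σ_{i} i(i+1) r_{n,i,k} H_{i+2}(k)`.
[cite: LaiSprangZudilin2026, Lemma 3.3 (def_rho_0)] -/
theorem pfRho0_eq_sum_halfInvPowSum (n : ℕ) : pfRho0 n =
    -∑ k ∈ range (n + 1), ∑ i ∈ (Icc 1 4 : Finset ℕ),
      (i : ℚ) * ((i : ℚ) + 1) * coeffR n i k * halfInvPowSum (i + 2) k := by
  rw [pfRho0, Finset.sum_comm]
  congr 1
  refine sum_congr rfl fun k _ => sum_congr rfl fun i _ => ?_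
  rw [halfInvPowSum, mul_sum]
  exact sum_congr rfl fun ℓ _ => by rw [div_eq_mul_inv]

/-- `ρ_{0,3} = 768`. [cite: LaiSprangZudilin2026, proof of Lemma 4.2 (b)] -/
theorem pfRho3_zero : pfRho3 0 = 768 := by
  rw [pfRho3, zero_add, Finset.sum_range_one, coeffR_zero (by norm_num) (by norm_num)]
  norm_num

/-- `ρ_{1,3} = 73728`. [cite: LaiSprangZudilin2026, proof of Lemma 4.2 (b)] -/
theorem pfRho3_one : pfRho3 1 = 73728 := by
  rw [pfRho3, Finset.sum_range_succ, Finset.sum_range_one, coeffR_one (by norm_num) (by norm_num) (by norm_num),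
    coeffR_one (by norm_num) (by norm_num) (by norm_num)]
  norm_num [coeffROne]

/-- `ρ_{0,0} = 0` (all inner sums are empty). [cite: LaiSprangZudilin2026, proof of Lemma 4.2 (b)] -/
theorem pfRho0_zero : pfRho0 0 = 0 := by
  simp [pfRho0]

/-- `ρ_{1,0} = −1024`. [cite: LaiSprangZudilin2026, proof of Lemma 4.2 (b)] -/
theorem pfRho0_one : pfRho0 1 = -1024 := by
  rw [pfRho0, sum_Icc_one_four]
  simp only [Finset.sum_range_succ, show (Icc 1 0 : Finset ℕ) = ∅ by decide,
    show (Icc 1 1 : Finset ℕ) = {1} by decide, Finset.sum_empty, Finset.sum_singleton]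
  rw [coeffR_one (by norm_num) (by norm_num) (by norm_num), coeffR_one (by norm_num) (by norm_num) (by norm_num),
    coeffR_one (by norm_num) (by norm_num) (by norm_num), coeffR_one (by norm_num) (by norm_num) (by norm_num)]
  norm_num [coeffROne]

/-! ## The certificate `T_n(t)(t+k)⁴` in brick form and its coefficients `a_{n,i,k}` -/

/-- The brick form of `T_n(t)(t+k)⁴`: `16·certPoly·(2^{2n}(t−½)_n/n!)⁴·(n!(t+k)/(t)_{n+1})⁴`, regular at `−k`.
[cite: LaiSprangZudilin2026, Lemma 4.1 (T_n) and proof of Lemma 4.2 (a)] -/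
def Treg (n k : ℕ) (t : ℚ) : ℚ :=
  16 * certPoly n t * halfBrick (-1) n t ^ 4 * Greg n k t ^ 4

/-- Off the poles and off `−k`: `Treg n k t = T_n(t)(t+k)⁴`. [cite: LaiSprangZudilin2026, Lemma 4.1 (T_n)] -/
theorem Treg_eq (n k : ℕ) {t : ℚ} (ht : ∀ j ∈ range (n + 1), t + j ≠ 0) (htk : t + k ≠ 0) :
    Treg n k t = T n t * (t + k) ^ 4 := by
  have hprod : ∏ j ∈ range (n + 1), (t + j) ≠ 0 := prod_ne_zero_iff.2 ht
  have hfac : (n ! : ℚ) ≠ 0 := by exact_mod_cast Nat.factorial_ne_zero n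
  unfold Treg T halfBrick
  rw [Greg_eq_mul_prod_inv n k htk, prod_inv_distrib]
  have e : ∏ j ∈ range n, (t + (((-1 : ℤ) : ℚ) + 1 / 2 + j)) = ∏ j ∈ range n, (t - 1 / 2 + j) :=
    prod_congr rfl fun j _ => by push_cast; ring
  rw [e]
  field_simp
  ring

/-- `Treg n k` is smooth at every `x` off the poles other than `−k`. [cite: LaiSprangZudilin2026, §4 (proof of Lemma 4.2 (a), the expansion of T_n)] -/
theorem contDiffAt_Treg (n k : ℕ) {x : ℚ} (hx : ∀ l ∈ range (n + 1), l ≠ k → x + l ≠ 0)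
    {N : WithTop ℕ∞} : ContDiffAt ℚ N (Treg n k) x := by
  unfold Treg certPoly
  exact ((by fun_prop : ContDiffAt ℚ N (fun t : ℚ => 16 * (8 * (2 * (n : ℚ) + 1) * t ^ 4
      + 48 * (n : ℚ) * (2 * n + 1) * t ^ 3 + 2 * (2 * (n : ℚ) + 1) * (48 * n ^ 2 - 6 * n - 5) * t ^ 2
      + 2 * (80 * (n : ℚ) ^ 4 + 16 * n ^ 3 - 28 * n ^ 2 - 3 * n + 3) * t
      + (48 * (n : ℚ) ^ 5 - 24 * n ^ 3 + 3 * n ^ 2 + 4 * n - 1))) x).mul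
    ((contDiffAt_halfBrick (-1) n x).pow 4)).mul ((contDiffAt_Greg n k hx).pow 4)

/-- `Treg n k` is smooth at `−k`. [cite: LaiSprangZudilin2026, §4 (proof of Lemma 4.2 (a), the expansion of T_n)] -/
theorem contDiffAt_Treg_neg (n k : ℕ) {N : WithTop ℕ∞} : ContDiffAt ℚ N (Treg n k) (-(k : ℚ)) :=
  contDiffAt_Treg n k fun _ _ hl => neg_add_ne_zero_of_ne hl

/-- The coefficient `a_{n,i,k} := 𝒟_{4−i}(T_n(t)(t+k)⁴)|_{t=−k}` of the expansion `T_n(t) = c_n + Σ a_{n,i,k}/(t+k)^i`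
(same formula for every `k`; zero for `k > n`). [cite: LaiSprangZudilin2026, §4 (proof of Lemma 4.2 (a))] -/
def coeffT (n i k : ℕ) : ℚ := divDeriv (4 - i) (Treg n k) (-(k : ℚ))

/-- For `k > n`, `Treg n k` is `(t+k)⁴` times a function smooth at `−k`. [folklore] -/
private theorem Treg_eq_pow_mul_of_lt (n : ℕ) {k : ℕ} (hk : n < k) (t : ℚ) :
    Treg n k t = (t - (-(k : ℚ))) ^ 4 *
      (16 * certPoly n t * halfBrick (-1) n t ^ 4 * (recipBrick 0 (n + 1) t) ^ 4) := by
  unfold Treg Greg recipBrickReg recipBrick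
  have hif : ¬ ((0 : ℤ) ≤ (k : ℤ) ∧ (k : ℤ) < 0 + ((n + 1 : ℕ) : ℤ)) := by push_cast; omega
  rw [if_neg hif]
  have hall : (range (n + 1)).filter (fun l : ℕ => (0 : ℤ) + (l : ℤ) ≠ k) = range (n + 1) := by
    refine filter_true_of_mem fun l hl => ?_
    have := mem_range.1 hl
    omega
  rw [hall, sub_neg_eq_add]
  push_cast
  ring

/-- `a_{n,i,k} = 0` for `k > n`, `i ≥ 1` («all the coefficients outside the eligible range vanish»).
[cite: LaiSprangZudilin2026, §4 (proof of Lemma 4.2 (a))] -/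
theorem coeffT_eq_zero_of_lt (n : ℕ) {k : ℕ} (hk : n < k) {i : ℕ} (hi : 1 ≤ i) : coeffT n i k = 0 := by
  have hg : ContDiffAt ℚ ((4 - i : ℕ) : WithTop ℕ∞)
      (fun t : ℚ => 16 * certPoly n t * halfBrick (-1) n t ^ 4 * (recipBrick 0 (n + 1) t) ^ 4) (-(k : ℚ)) := by
    refine (ContDiffAt.mul ?_ ((contDiffAt_halfBrick (-1) n _).pow 4)).mul (ContDiffAt.pow ?_ 4)
    · unfold certPoly; fun_prop
    · unfold recipBrick
      refine contDiffAt_const.mul (contDiffAt_prod fun l hl => contDiffAt_inv_add_const ?_)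
      have := mem_range.1 hl
      push_cast
      simp only [zero_add]
      exact neg_add_ne_zero_of_ne (by omega)
  rw [coeffT, show Treg n k = fun t => (t - (-(k : ℚ))) ^ 4 *
      (16 * certPoly n t * halfBrick (-1) n t ^ 4 * (recipBrick 0 (n + 1) t) ^ 4) from
    funext (Treg_eq_pow_mul_of_lt n hk), divDeriv_sub_pow_mul hg 4, if_pos (by omega)]

/-- The polynomial `certPoly` as an element of `ℚ[X]`. [cite: LaiSprangZudilin2026, Lemma 4.1 (T_n)] -/
def certPolyX (n : ℕ) : ℚ[X] :=
  C (8 * (2 * (n : ℚ) + 1)) * X ^ 4 + C (48 * (n : ℚ) * (2 * n + 1)) * X ^ 3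
    + C (2 * (2 * (n : ℚ) + 1) * (48 * n ^ 2 - 6 * n - 5)) * X ^ 2
    + C (2 * (80 * (n : ℚ) ^ 4 + 16 * n ^ 3 - 28 * n ^ 2 - 3 * n + 3)) * X
    + C (48 * (n : ℚ) ^ 5 - 24 * n ^ 3 + 3 * n ^ 2 + 4 * n - 1)

/-- `certPolyX` evaluates to `certPoly`. [cite: LaiSprangZudilin2026, Lemma 4.1 (T_n)] -/
theorem eval_certPolyX (n : ℕ) (t : ℚ) : (certPolyX n).eval t = certPoly n t := by
  simp [certPolyX, certPoly]

/-- `deg certPoly ≤ 4`. [cite: LaiSprangZudilin2026, Lemma 4.1 (T_n: «a polynomial of degree at most 12 in t»)] -/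
theorem natDegree_certPolyX_le (n : ℕ) : (certPolyX n).natDegree ≤ 4 := by
  unfold certPolyX
  compute_degree

/-- `T_n` is smooth off its poles `0, −1, …, −n`. [cite: LaiSprangZudilin2026, Lemma 4.1 (T_n)] -/
theorem contDiffAt_T (n : ℕ) {x : ℚ} (hx : ∀ j ∈ range (n + 1), x + j ≠ 0) {N : WithTop ℕ∞} :
    ContDiffAt ℚ N (T n) x := by
  unfold T certPoly
  refine ContDiffAt.div (by fun_prop) (by fun_prop) ?_
  exact pow_ne_zero _ (prod_ne_zero_iff.2 hx)

/-- EXISTENCE of an expansion `T_n(t) = c_n + Σ_{k ≤ n} Σ_{s ≤ 4} c_{k,s}(t+k)^{−s}` off the poles: the numerator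
`16·certPoly·2^{8n}(t−½)_n⁴` has degree `≤ 4n+4 = 4(n+1)`, so the polynomial part is a constant.
[cite: LaiSprangZudilin2026, §4 (proof of Lemma 4.2 (a): «deg T_n = 0, hence … c_n + Σ a_{n,i,k}/(t+k)^i»)] -/
theorem exists_T_eq_const_add_pfEval (n : ℕ) : ∃ (cT : ℚ) (c : ℕ → ℕ → ℚ), ∀ t : ℚ,
    (∀ i ∈ range (n + 1), t + i ≠ 0) → T n t = cT + pfEval (range (n + 1)) (fun _ => 4) c t := by
  classical
  set P : ℚ[X] := C 16 * certPolyX n * C ((2 : ℚ) ^ (8 * n)) *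
      (∏ j ∈ range n, (X + C (-(1 : ℚ) / 2 + j))) ^ 4 with hP
  have hdegP : P.natDegree ≤ 4 * n + 4 := by
    have h1 := (natDegree_pow_le (p := ∏ j ∈ range n, (X + C (-(1 : ℚ) / 2 + j))) (n := 4)).trans
      (Nat.mul_le_mul_left 4 (natDegree_prod_X_add_C_le n fun j => -(1 : ℚ) / 2 + j))
    have h2 : (C 16 * certPolyX n * C ((2 : ℚ) ^ (8 * n)) : ℚ[X]).natDegree ≤ 4 := by
      refine natDegree_mul_le.trans ?_
      rw [natDegree_C, add_zero]
      refine natDegree_mul_le.trans ?_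
      rw [natDegree_C, zero_add]
      exact natDegree_certPolyX_le n
    refine (natDegree_mul_le.trans (add_le_add h2 h1)).trans ?_
    omega
  obtain ⟨Q, hQ, c, hc⟩ := exists_isPF_eval_mul_prod_inv_sub (range (n + 1)) P (shifts4 n)
    (fun i hi => mem_range_of_mem_shifts4 hi)
  have hQ0 : Q.natDegree = 0 := by
    rcases hQ with h | h
    · rw [h, natDegree_zero]
    · rw [length_shifts4] at h; omega
  have hPeval : ∀ t : ℚ, P.eval t = 16 * certPoly n t * 2 ^ (8 * n) * (∏ j ∈ range n, (t - 1 / 2 + j)) ^ 4 := by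
    intro t
    rw [hP]
    simp only [eval_mul, eval_C, eval_pow, eval_prod, eval_add, eval_X, eval_certPolyX]
    congr 2
    exact prod_congr rfl fun j _ => by ring
  have hT : ∀ t : ℚ, T n t = P.eval t * ((shifts4 n).map fun i : ℕ => (t + (i : ℚ))⁻¹).prod := by
    intro t
    rw [prod_shifts4, T, hPeval, div_eq_mul_inv]
  have hPF : IsPF (range (n + 1)) (fun i => (shifts4 n).count i) (fun t => T n t - Q.coeff 0) := by
    refine ⟨c, fun t ht => ?_⟩
    have h := hc t ht
    simp only at h
    rw [eq_C_of_natDegree_eq_zero hQ0, eval_C] at h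
    show T n t - Q.coeff 0 = _
    rw [← h, hT t]
  obtain ⟨c', hc'⟩ := hPF.mono fun i _ => count_shifts4_le n i
  exact ⟨Q.coeff 0, c', fun t ht => by rw [← hc' t ht]; ring⟩

/-- For ANY expansion `T_n = c_n + Σ c_{k,s}(t+k)^{−s}` off the poles, `c_{k,i} = a_{n,i,k}` (`k ≤ n`, `1 ≤ i ≤ 4`).
[cite: LaiSprangZudilin2026, §4 (proof of Lemma 4.2 (a))] -/
theorem coeffT_eq_of_pfEval (n : ℕ) {cT : ℚ} {c : ℕ → ℕ → ℚ}
    (hc : ∀ t : ℚ, (∀ i ∈ range (n + 1), t + i ≠ 0) → T n t = cT + pfEval (range (n + 1)) (fun _ => 4) c t)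
    {k : ℕ} (hk : k ≤ n) {i : ℕ} (hi1 : 1 ≤ i) (hi4 : i ≤ 4) : coeffT n i k = c k i := by
  have hk' : k ∈ range (n + 1) := mem_range.2 (by omega)
  have h := divDeriv_eq_coeff_of_pfEval (T := range (n + 1)) (A := 4) (f := T n) (g := Treg n k)
    (q := fun _ => cT) (c := c) hk' contDiffAt_const hc (contDiffAt_Treg_neg n k (N := 0)).continuousAt
    (fun t ht => Treg_eq n k ht (ht k hk')) (a := 4 - i) (by omega)
  rw [coeffT, h, show 4 - (4 - i) = i by omega]

/-- The expansion of `T_n` with its coefficients: `T_n(t) = c_n + Σ_{k ≤ n} Σ_{i=1}^{4} a_{n,i,k}(t+k)^{−i}` off the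
poles. [cite: LaiSprangZudilin2026, §4 (proof of Lemma 4.2 (a))] -/
theorem exists_T_eq_const_add_sum_coeffT (n : ℕ) : ∃ cT : ℚ, ∀ t : ℚ, (∀ j ∈ range (n + 1), t + j ≠ 0) →
    T n t = cT + ∑ k ∈ range (n + 1), ∑ i ∈ Icc 1 4, coeffT n i k * ((t + k) ^ i)⁻¹ := by
  obtain ⟨cT, c, hc⟩ := exists_T_eq_const_add_pfEval n
  refine ⟨cT, fun t ht => ?_⟩
  rw [hc t ht, pfEval]
  congr 1
  refine sum_congr rfl fun k hk => sum_congr rfl fun i hi => ?_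
  have hi' := mem_Icc.1 hi
  rw [coeffT_eq_of_pfEval n hc (by have := mem_range.1 hk; omega) hi'.1 hi'.2]

/-! ## (4.2): the recursion for the coefficients, from Lemma 4.1 -/

/-- `𝒟_j` of a three-term linear combination. [folklore] -/
private theorem divDeriv_lincomb3 {j : ℕ} {f g h : ℚ → ℚ} {x : ℚ} (a b c : ℚ) (hf : ContDiffAt ℚ j f x)
    (hg : ContDiffAt ℚ j g x) (hh : ContDiffAt ℚ j h x) :
    divDeriv j (fun t => a * f t - b * g t + c * h t) x =
      a * divDeriv j f x - b * divDeriv j g x + c * divDeriv j h x := by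
  have e : (fun t => a * f t - b * g t + c * h t) = fun t => (a * f t + (-b) * g t) + c * h t := by
    funext t; ring
  have hf' : ContDiffAt ℚ j (fun t => a * f t) x := contDiffAt_const.mul hf
  have hg' : ContDiffAt ℚ j (fun t => (-b) * g t) x := contDiffAt_const.mul hg
  have hh' : ContDiffAt ℚ j (fun t => c * h t) x := contDiffAt_const.mul hh
  rw [e, divDeriv_fun_add (hf'.add hg') hh', divDeriv_fun_add hf' hg', divDeriv_const_mul, divDeriv_const_mul,
    divDeriv_const_mul]
  ring

/-- `𝒟_j` of a difference (`fun` form). [folklore] -/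
private theorem divDeriv_fun_sub {j : ℕ} {f g : ℚ → ℚ} {x : ℚ} (hf : ContDiffAt ℚ j f x) (hg : ContDiffAt ℚ j g x) :
    divDeriv j (fun t => f t - g t) x = divDeriv j f x - divDeriv j g x := by
  have e : (fun t => f t - g t) = fun t => f t + (-1) * g t := by funext t; ring
  rw [e, divDeriv_fun_add hf (contDiffAt_const.mul hg), divDeriv_const_mul]
  ring

/-- **(4.2)** for `k ≥ 1`: `(n+1)⁵ r_{n+1,i,k} − 32(2n+1)(8n⁴+16n³+20n²+12n+3) r_{n,i,k} + 2¹⁶n⁵ r_{n−1,i,k}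
= a_{n,i,k−1} − a_{n,i,k}` — obtained from Lemma 4.1 by multiplying by `(t+k)⁴` and taking the Taylor
coefficient of order `4 − i` at `−k` (so no uniqueness statement is needed).
[cite: LaiSprangZudilin2026, §4 (proof of Lemma 4.2 (a), display (4.2))] -/
theorem coeff_recurrence {n : ℕ} (hn : 1 ≤ n) {k : ℕ} (hk : 1 ≤ k) (i : ℕ) :
    ((n : ℚ) + 1) ^ 5 * coeffR (n + 1) i k - (recMid n : ℚ) * coeffR n i k
      + 2 ^ 16 * (n : ℚ) ^ 5 * coeffR (n - 1) i k = coeffT n i (k - 1) - coeffT n i k := by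
  have hcast : (-(k : ℚ)) + 1 = -(((k - 1 : ℕ) : ℚ)) := by rw [Nat.cast_sub hk]; push_cast; ring
  have hshift : ∀ {N : WithTop ℕ∞}, ContDiffAt ℚ N (fun t : ℚ => Treg n (k - 1) (t + 1)) (-(k : ℚ)) := by
    intro N
    have h := contDiffAt_Treg_neg n (k - 1) (N := N)
    rw [← hcast] at h
    exact h.comp (-(k : ℚ)) (contDiffAt_id.add contDiffAt_const)
  -- the two germs agree near `-k`
  have hgerm : (fun t => ((n : ℚ) + 1) ^ 5 * Rreg (n + 1) k t - (recMid n : ℚ) * Rreg n k t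
      + 2 ^ 16 * (n : ℚ) ^ 5 * Rreg (n - 1) k t) =ᶠ[𝓝 (-(k : ℚ))]
      (fun t => Treg n (k - 1) (t + 1) - Treg n k t) := by
    refine eventuallyEq_of_nhdsNE ?_ ?_ ?_
    · exact ((((contDiffAt_const.mul (contDiffAt_Rreg_neg (n + 1) k (N := 0))).sub
        (contDiffAt_const.mul (contDiffAt_Rreg_neg n k (N := 0)))).add
        (contDiffAt_const.mul (contDiffAt_Rreg_neg (n - 1) k (N := 0)))).continuousAt)
    · exact ((hshift (N := 0)).sub (contDiffAt_Treg_neg n k (N := 0))).continuousAt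
    filter_upwards [eventually_nhdsNE_forall_add_ne_zero (range (n + 2 + k)) k] with t ht
    have htk : t + k ≠ 0 := ht k (mem_range.2 (by omega))
    have h41 := lemma41 hn t (fun j hj => ht j (mem_range.2 (by omega)))
    rw [Rreg_eq (n + 1) k (fun j hj => ht j (mem_range.2 (by have := mem_range.1 hj; omega))) htk,
      Rreg_eq n k (fun j hj => ht j (mem_range.2 (by have := mem_range.1 hj; omega))) htk,
      Rreg_eq (n - 1) k (fun j hj => ht j (mem_range.2 (by have := mem_range.1 hj; omega))) htk,
      Treg_eq n k (fun j hj => ht j (mem_range.2 (by have := mem_range.1 hj; omega))) htk,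
      Treg_eq n (k - 1) (t := t + 1) (fun j hj => by
        have := ht (j + 1) (mem_range.2 (by have := mem_range.1 hj; omega))
        push_cast at this
        exact fun h => this (by linarith)) (by rw [add_assoc, Nat.cast_sub hk]; push_cast; rwa [add_sub_cancel])]
    rw [Nat.cast_sub hk]
    push_cast
    rw [show t + 1 + ((k : ℚ) - 1) = t + k by ring]
    linear_combination (t + (k : ℚ)) ^ 4 * h41
  have hD := divDeriv_congr (j := 4 - i) hgerm
  rw [divDeriv_lincomb3 _ _ _ (contDiffAt_Rreg_neg (n + 1) k) (contDiffAt_Rreg_neg n k)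
    (contDiffAt_Rreg_neg (n - 1) k), divDeriv_fun_sub hshift (contDiffAt_Treg_neg n k),
    divDeriv_comp_add_const (4 - i) (Treg n (k - 1)) 1 (-(k : ℚ)), hcast] at hD
  simpa only [coeffR, coeffT] using hD

/-- **(4.2)** at `k = 0` (`i ≥ 1`): `(n+1)⁵ r_{n+1,i,0} − μ_n r_{n,i,0} + 2¹⁶n⁵ r_{n−1,i,0} = −a_{n,i,0}`
(«`a_{n,i,−1} = 0`»: `T_n(t+1)` is regular at `t = 0`). [cite: LaiSprangZudilin2026, §4 (proof of Lemma 4.2 (a), (4.2))] -/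
theorem coeff_recurrence_zero {n : ℕ} (hn : 1 ≤ n) {i : ℕ} (hi : 1 ≤ i) :
    ((n : ℚ) + 1) ^ 5 * coeffR (n + 1) i 0 - (recMid n : ℚ) * coeffR n i 0
      + 2 ^ 16 * (n : ℚ) ^ 5 * coeffR (n - 1) i 0 = -coeffT n i 0 := by
  have hshift : ∀ {N : WithTop ℕ∞}, ContDiffAt ℚ N (fun t : ℚ => T n (t + 1)) 0 := by
    intro N
    have h := contDiffAt_T n (x := (0 : ℚ) + 1) (fun j _ => by positivity) (N := N)
    exact h.comp (0 : ℚ) (contDiffAt_id.add contDiffAt_const)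
  have hgerm : (fun t => ((n : ℚ) + 1) ^ 5 * Rreg (n + 1) 0 t - (recMid n : ℚ) * Rreg n 0 t
      + 2 ^ 16 * (n : ℚ) ^ 5 * Rreg (n - 1) 0 t) =ᶠ[𝓝 (-((0 : ℕ) : ℚ))]
      (fun t => (t - 0) ^ 4 * T n (t + 1) - Treg n 0 t) := by
    refine eventuallyEq_of_nhdsNE ?_ ?_ ?_
    · exact ((((contDiffAt_const.mul (contDiffAt_Rreg_neg (n + 1) 0 (N := 0))).sub
        (contDiffAt_const.mul (contDiffAt_Rreg_neg n 0 (N := 0)))).add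
        (contDiffAt_const.mul (contDiffAt_Rreg_neg (n - 1) 0 (N := 0)))).continuousAt)
    · have h0 : ContDiffAt ℚ 0 (fun t : ℚ => (t - 0) ^ 4 * T n (t + 1)) (-((0 : ℕ) : ℚ)) := by
        rw [Nat.cast_zero, neg_zero]
        exact (contDiffAt_sub_pow _ _ _).mul hshift
      exact (h0.sub (contDiffAt_Treg_neg n 0 (N := 0))).continuousAt
    filter_upwards [eventually_nhdsNE_forall_add_ne_zero (range (n + 2)) 0] with t ht
    have ht0 : t + ((0 : ℕ) : ℚ) ≠ 0 := ht 0 (mem_range.2 (by omega))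
    have h41 := lemma41 hn t (fun j hj => ht j (mem_range.2 (by omega)))
    rw [Rreg_eq (n + 1) 0 (fun j hj => ht j (mem_range.2 (by have := mem_range.1 hj; omega))) ht0,
      Rreg_eq n 0 (fun j hj => ht j (mem_range.2 (by have := mem_range.1 hj; omega))) ht0,
      Rreg_eq (n - 1) 0 (fun j hj => ht j (mem_range.2 (by have := mem_range.1 hj; omega))) ht0,
      Treg_eq n 0 (fun j hj => ht j (mem_range.2 (by have := mem_range.1 hj; omega))) ht0]
    push_cast
    linear_combination t ^ 4 * h41
  have hD := divDeriv_congr (j := 4 - i) hgerm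
  rw [divDeriv_lincomb3 _ _ _ (contDiffAt_Rreg_neg (n + 1) 0) (contDiffAt_Rreg_neg n 0)
    (contDiffAt_Rreg_neg (n - 1) 0)] at hD
  have hsub : divDeriv (4 - i) (fun t : ℚ => (t - 0) ^ 4 * T n (t + 1) - Treg n 0 t) (-((0 : ℕ) : ℚ))
      = -divDeriv (4 - i) (Treg n 0) (-((0 : ℕ) : ℚ)) := by
    have hz : divDeriv (4 - i) (fun t : ℚ => (t - 0) ^ 4 * T n (t + 1)) 0 = 0 := by
      rw [divDeriv_sub_pow_mul hshift 4, if_pos (by omega)]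
    have h1 : ContDiffAt ℚ ((4 - i : ℕ) : WithTop ℕ∞) (fun t : ℚ => (t - 0) ^ 4 * T n (t + 1)) (-((0 : ℕ) : ℚ)) := by
      rw [Nat.cast_zero, neg_zero]
      exact (contDiffAt_sub_pow _ _ _).mul hshift
    rw [divDeriv_fun_sub h1 (contDiffAt_Treg_neg n 0)]
    have hz' : divDeriv (4 - i) (fun t : ℚ => (t - 0) ^ 4 * T n (t + 1)) (-((0 : ℕ) : ℚ)) = 0 := by
      rw [Nat.cast_zero, neg_zero]; exact hz
    rw [hz', zero_sub]
  rw [hsub] at hD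
  simpa only [coeffR, coeffT] using hD

/-! ## `T_n″(½) = 0` in coefficient form -/

/-- `𝒟₂[(t+c)^{−s}](x) = ½ s(s+1)(x+c)^{−s−2}` (Mathlib's conventions make this an identity at every `x`) — the
termwise second derivative behind «`−T_n″(½)`» and `R_n″` (Remark 3.4).
[cite: LaiSprangZudilin2026, §4 (proof of Lemma 4.2 (a), T_n″) and Remark 3.4 (R_n″)] -/
theorem divDeriv_two_inv_pow (s : ℕ) (c x : ℚ) :
    divDeriv 2 (fun t : ℚ => ((t + c) ^ s)⁻¹) x = (s : ℚ) * (s + 1) / 2 * ((x + c) ^ (s + 2))⁻¹ := by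
  have hfun : (fun y : ℚ => ((y + c) ^ s)⁻¹) = fun y => (fun z : ℚ => z ^ (-(s : ℤ))) (y + c) := by
    funext y
    simp only [zpow_neg, zpow_natCast]
  rw [divDeriv, hfun, iteratedDeriv_comp_add_const 2 (fun z : ℚ => z ^ (-(s : ℤ))) c]
  simp only
  rw [iteratedDeriv_eq_iterate, iter_deriv_zpow,
    show (-(s : ℤ) - (2 : ℕ)) = -((s + 2 : ℕ) : ℤ) by push_cast; ring, zpow_neg, zpow_natCast]
  simp [Finset.prod_range_succ, Nat.factorial]
  ring

/-- A neighbourhood of a non-pole avoids the poles (so the expansion (def_rik) may be differentiated termwise there).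
[cite: LaiSprangZudilin2026, §3 (def_rik) and §4 (proof of Lemma 4.2 (a))] -/
theorem eventually_nhds_forall_add_ne_zero (S : Finset ℕ) {x : ℚ} (hx : ∀ j ∈ S, x + j ≠ 0) :
    ∀ᶠ t : ℚ in 𝓝 x, ∀ j ∈ S, t + j ≠ 0 := by
  rw [eventually_all_finset]
  intro j hj
  exact ((continuous_id.add continuous_const).continuousAt (x := x)).eventually_ne (hx j hj)

/-- For `n ≥ 1`, `T_n(t) = (t−½)⁴ · g(t)` with `g` regular at `½` (the factor `j = 0` of `(t−½)_n⁴`).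
[cite: LaiSprangZudilin2026, Lemma 4.1 (T_n) and proof of Lemma 4.2 (a) («−T_n″(½) = 0»)] -/
theorem T_eq_pow_mul {n : ℕ} (hn : 1 ≤ n) (t : ℚ) :
    T n t = (t - 1 / 2) ^ 4 * (16 * certPoly n t * 2 ^ (8 * n) *
      (∏ j ∈ range (n - 1), (t + 1 / 2 + j)) ^ 4 / (∏ j ∈ range (n + 1), (t + j)) ^ 4) := by
  obtain ⟨m, rfl⟩ : ∃ m, n = m + 1 := ⟨n - 1, by omega⟩
  rw [T, Nat.add_sub_cancel, prod_shift_half m t]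
  ring

/-- **`𝒟₂ T_n(½) = 0`** (`n ≥ 1`): «`−T_n″(½) = 0`». [cite: LaiSprangZudilin2026, §4 (proof of Lemma 4.2 (a))] -/
theorem divDeriv_two_T_half {n : ℕ} (hn : 1 ≤ n) : divDeriv 2 (T n) (1 / 2) = 0 := by
  have hden : ∀ j ∈ range (n + 1), (1 / 2 : ℚ) + j ≠ 0 := fun j _ => by positivity
  have hg : ContDiffAt ℚ ((2 : ℕ) : WithTop ℕ∞) (fun t : ℚ => 16 * certPoly n t * 2 ^ (8 * n) *
      (∏ j ∈ range (n - 1), (t + 1 / 2 + j)) ^ 4 / (∏ j ∈ range (n + 1), (t + j)) ^ 4) (1 / 2) := by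
    unfold certPoly
    refine ContDiffAt.div (by fun_prop) (by fun_prop) ?_
    exact pow_ne_zero _ (prod_ne_zero_iff.2 hden)
  rw [show T n = fun t => (t - 1 / 2) ^ 4 * (16 * certPoly n t * 2 ^ (8 * n) *
      (∏ j ∈ range (n - 1), (t + 1 / 2 + j)) ^ 4 / (∏ j ∈ range (n + 1), (t + j)) ^ 4) from
    funext (T_eq_pow_mul hn), divDeriv_sub_pow_mul hg 4, if_pos (by norm_num)]

/-- **`T_n″(½) = 0` through the expansion**: for `n ≥ 1`,
`Σ_{k ≤ n} Σ_{i=1}^{4} i(i+1) a_{n,i,k} (k+½)^{−(i+2)} = 0`.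
[cite: LaiSprangZudilin2026, §4 (proof of Lemma 4.2 (a): «= −T_n″(½) = 0»)] -/
theorem sum_coeffT_half_eq_zero {n : ℕ} (hn : 1 ≤ n) :
    ∑ k ∈ range (n + 1), ∑ i ∈ (Icc 1 4 : Finset ℕ),
      (i : ℚ) * ((i : ℚ) + 1) * coeffT n i k * ((((k : ℚ) + 1 / 2)) ^ (i + 2))⁻¹ = 0 := by
  obtain ⟨cT, hT⟩ := exists_T_eq_const_add_sum_coeffT n
  have hden : ∀ j ∈ range (n + 1), (1 / 2 : ℚ) + j ≠ 0 := fun j _ => by positivity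
  have hgerm : T n =ᶠ[𝓝 (1 / 2 : ℚ)]
      fun t => cT + ∑ k ∈ range (n + 1), ∑ i ∈ Icc 1 4, coeffT n i k * ((t + k) ^ i)⁻¹ :=
    (eventually_nhds_forall_add_ne_zero (range (n + 1)) hden).mono fun t ht => hT t ht
  have hterm : ∀ k ∈ range (n + 1), ∀ i ∈ (Icc 1 4 : Finset ℕ),
      ContDiffAt ℚ ((2 : ℕ) : WithTop ℕ∞) (fun t : ℚ => coeffT n i k * ((t + k) ^ i)⁻¹) (1 / 2) := by
    intro k hk i _
    exact contDiffAt_const.mul (((contDiffAt_id.add contDiffAt_const).pow i).inv (pow_ne_zero _ (hden k hk)))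
  have hsum : ∀ k ∈ range (n + 1), ContDiffAt ℚ ((2 : ℕ) : WithTop ℕ∞)
      (fun t : ℚ => ∑ i ∈ Icc 1 4, coeffT n i k * ((t + k) ^ i)⁻¹) (1 / 2) :=
    fun k hk => ContDiffAt.sum fun i hi => hterm k hk i hi
  have hD := divDeriv_two_T_half hn
  rw [divDeriv_congr hgerm, divDeriv_fun_add contDiffAt_const (ContDiffAt.sum fun k hk => hsum k hk),
    divDeriv_const, if_neg (by norm_num), zero_add, divDeriv_sum fun k hk => hsum k hk] at hD
  have hD' : ∑ k ∈ range (n + 1), ∑ i ∈ (Icc 1 4 : Finset ℕ),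
      coeffT n i k * ((i : ℚ) * (i + 1) / 2 * (((1 / 2 : ℚ) + k) ^ (i + 2))⁻¹) = 0 := by
    rw [← hD]
    refine sum_congr rfl fun k hk => ?_
    rw [divDeriv_sum fun i hi => hterm k hk i hi]
    refine sum_congr rfl fun i _ => ?_
    rw [divDeriv_const_mul, divDeriv_two_inv_pow]
  have e : ∑ k ∈ range (n + 1), ∑ i ∈ (Icc 1 4 : Finset ℕ),
      (i : ℚ) * ((i : ℚ) + 1) * coeffT n i k * ((((k : ℚ) + 1 / 2)) ^ (i + 2))⁻¹
      = 2 * ∑ k ∈ range (n + 1), ∑ i ∈ (Icc 1 4 : Finset ℕ),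
        coeffT n i k * ((i : ℚ) * (i + 1) / 2 * (((1 / 2 : ℚ) + k) ^ (i + 2))⁻¹) := by
    rw [mul_sum]
    refine sum_congr rfl fun k _ => ?_
    rw [mul_sum]
    refine sum_congr rfl fun i _ => ?_
    rw [add_comm (k : ℚ) (1 / 2)]
    ring
  rw [e, hD', mul_zero]

/-! ## Lemma 4.2 (a) -/

/-- Extending the `k`-range of a weighted sum of the `r_{n,i,k}` by zeros. [folklore] -/
private theorem sum_coeffR_extend (m : ℕ) {M : ℕ} (hM : m + 1 ≤ M) {i : ℕ} (hi : 1 ≤ i) (w : ℕ → ℚ) :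
    ∑ k ∈ range (m + 1), w k * coeffR m i k = ∑ k ∈ range M, w k * coeffR m i k := by
  refine Finset.sum_subset (range_mono hM) fun k hk hk' => ?_
  rw [coeffR_eq_zero_of_lt m (by have := mem_range.1 hk; rw [mem_range] at hk'; omega) hi, mul_zero]

/-- Abel summation for the telescoping right-hand side of (4.2). [folklore] -/
private theorem sum_mul_sub_succ (H a : ℕ → ℚ) (M : ℕ) :
    ∑ k ∈ range M, H (k + 1) * (a k - a (k + 1))
      = ∑ k ∈ range M, (H (k + 1) - H k) * a k + H 0 * a 0 - H M * a M := by
  induction M with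
  | zero => simp
  | succ M ih => rw [sum_range_succ, sum_range_succ, ih]; ring

/-- The summed right-hand side of (4.2): for `i ≥ 1` and any weights `H`,
`Σ_{k ≤ n+1} H(k)·RHS_{i,k} = Σ_{k ≤ n} (H(k+1) − H(k)) a_{n,i,k}` where `RHS_{i,0} = −a_{n,i,0}` and
`RHS_{i,k} = a_{n,i,k−1} − a_{n,i,k}` (Abel summation; `a_{n,i,n+1} = 0`).
[cite: LaiSprangZudilin2026, §4 (proof of Lemma 4.2 (a))] -/
private theorem sum_weight_rhs {n : ℕ} {i : ℕ} (hi : 1 ≤ i) (H : ℕ → ℚ) :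
    ∑ k ∈ range (n + 2), H k * ((if k = 0 then 0 else coeffT n i (k - 1)) - coeffT n i k)
      = ∑ k ∈ range (n + 1), (H (k + 1) - H k) * coeffT n i k := by
  rw [sum_range_succ' _ (n + 1), if_pos rfl, zero_sub]
  have e : ∀ k ∈ range (n + 1),
      H (k + 1) * ((if k + 1 = 0 then (0 : ℚ) else coeffT n i (k + 1 - 1)) - coeffT n i (k + 1))
        = H (k + 1) * (coeffT n i k - coeffT n i (k + 1)) := fun k _ => by
    rw [if_neg (Nat.succ_ne_zero k), Nat.add_sub_cancel]
  rw [sum_congr rfl e, sum_mul_sub_succ H (coeffT n i) (n + 1),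
    coeffT_eq_zero_of_lt n (k := n + 1) (by omega) hi]
  ring

/-- The combination (4.2) at `(i,k)`, `k ≤ n+1`, with the boundary conventions.
[cite: LaiSprangZudilin2026, §4 (proof of Lemma 4.2 (a), (4.2))] -/
private theorem coeff_recurrence' {n : ℕ} (hn : 1 ≤ n) {i : ℕ} (hi : 1 ≤ i) (k : ℕ) :
    ((n : ℚ) + 1) ^ 5 * coeffR (n + 1) i k - (recMid n : ℚ) * coeffR n i k
      + 2 ^ 16 * (n : ℚ) ^ 5 * coeffR (n - 1) i k
      = (if k = 0 then 0 else coeffT n i (k - 1)) - coeffT n i k := by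
  rcases Nat.eq_zero_or_pos k with rfl | hk
  · rw [if_pos rfl, zero_sub]; exact coeff_recurrence_zero hn hi
  · rw [if_neg (by omega)]; exact coeff_recurrence hn hk i

/-- **Lemma 4.2 (a) for `ρ_{n,3}`** (PROVED): `(n+1)⁵ρ_{n+1,3} − μ_n ρ_{n,3} + 2¹⁶n⁵ρ_{n−1,3} = 0` for `n ≥ 1`,
`μ_n = 32(2n+1)(8n⁴+16n³+20n²+12n+3)` — «Taking `i = 3` in (4.2), summing over `k` and using (def_rho_3)».
[cite: LaiSprangZudilin2026, Lemma 4.2 (a)] -/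
theorem pfRho3_rec {n : ℕ} (hn : 1 ≤ n) :
    ((n : ℚ) + 1) ^ 5 * pfRho3 (n + 1) - (recMid n : ℚ) * pfRho3 n + 2 ^ 16 * (n : ℚ) ^ 5 * pfRho3 (n - 1) = 0 := by
  have h3 : (1 : ℕ) ≤ 3 := by norm_num
  have e1 : pfRho3 (n + 1) = 384 * ∑ k ∈ range (n + 2), 1 * coeffR (n + 1) 3 k := by
    rw [pfRho3]; simp
  have e2 : pfRho3 n = 384 * ∑ k ∈ range (n + 2), 1 * coeffR n 3 k := by
    rw [pfRho3, ← sum_coeffR_extend n (by omega) h3 (fun _ => 1)]; simp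
  have e3 : pfRho3 (n - 1) = 384 * ∑ k ∈ range (n + 2), 1 * coeffR (n - 1) 3 k := by
    rw [pfRho3, ← sum_coeffR_extend (n - 1) (by omega) h3 (fun _ => 1)]; simp
  rw [e1, e2, e3]
  simp only [one_mul]
  have key : ((n : ℚ) + 1) ^ 5 * (384 * ∑ k ∈ range (n + 2), coeffR (n + 1) 3 k)
      - (recMid n : ℚ) * (384 * ∑ k ∈ range (n + 2), coeffR n 3 k)
      + 2 ^ 16 * (n : ℚ) ^ 5 * (384 * ∑ k ∈ range (n + 2), coeffR (n - 1) 3 k)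
      = 384 * ∑ k ∈ range (n + 2), (1 : ℚ) * ((if k = 0 then 0 else coeffT n 3 (k - 1)) - coeffT n 3 k) := by
    simp only [mul_sum, ← sum_sub_distrib, ← sum_add_distrib]
    refine sum_congr rfl fun k _ => ?_
    rw [← coeff_recurrence' hn h3 k]
    ring
  rw [key, sum_weight_rhs h3 (fun _ => 1)]
  simp

/-- **Lemma 4.2 (a) for `ρ_{n,0}`** (PROVED): `(n+1)⁵ρ_{n+1,0} − μ_n ρ_{n,0} + 2¹⁶n⁵ρ_{n−1,0} = 0` for `n ≥ 1`.  The
printed proof goes through the 2-adic integrals `S_n` and `−T_n″(½) = 0`; here the same vanishing `T_n″(½) = 0`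
is fed directly into (4.2) weighted by `i(i+1)H_{i+2}(k)`.
[cite: LaiSprangZudilin2026, Lemma 4.2 (a)] -/
theorem pfRho0_rec {n : ℕ} (hn : 1 ≤ n) :
    ((n : ℚ) + 1) ^ 5 * pfRho0 (n + 1) - (recMid n : ℚ) * pfRho0 n + 2 ^ 16 * (n : ℚ) ^ 5 * pfRho0 (n - 1) = 0 := by
  -- the three `ρ`'s as sums over `k < n+2`, `i`-sum outside
  have ext : ∀ m : ℕ, m + 1 ≤ n + 2 → pfRho0 m = -∑ i ∈ (Icc 1 4 : Finset ℕ), ∑ k ∈ range (n + 2),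
      ((i : ℚ) * ((i : ℚ) + 1) * halfInvPowSum (i + 2) k) * coeffR m i k := by
    intro m hm
    rw [pfRho0_eq_sum_halfInvPowSum, sum_comm]
    congr 1
    refine sum_congr rfl fun i hi => ?_
    rw [← sum_coeffR_extend m hm (mem_Icc.1 hi).1]
    exact sum_congr rfl fun k _ => by ring
  rw [ext (n + 1) (by omega), ext n (by omega), ext (n - 1) (by omega)]
  have key : ((n : ℚ) + 1) ^ 5 * -∑ i ∈ (Icc 1 4 : Finset ℕ), ∑ k ∈ range (n + 2),
        ((i : ℚ) * ((i : ℚ) + 1) * halfInvPowSum (i + 2) k) * coeffR (n + 1) i k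
      - (recMid n : ℚ) * -∑ i ∈ (Icc 1 4 : Finset ℕ), ∑ k ∈ range (n + 2),
        ((i : ℚ) * ((i : ℚ) + 1) * halfInvPowSum (i + 2) k) * coeffR n i k
      + 2 ^ 16 * (n : ℚ) ^ 5 * -∑ i ∈ (Icc 1 4 : Finset ℕ), ∑ k ∈ range (n + 2),
        ((i : ℚ) * ((i : ℚ) + 1) * halfInvPowSum (i + 2) k) * coeffR (n - 1) i k
      = -∑ i ∈ (Icc 1 4 : Finset ℕ), (i : ℚ) * ((i : ℚ) + 1) * ∑ k ∈ range (n + 2),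
        halfInvPowSum (i + 2) k * ((if k = 0 then 0 else coeffT n i (k - 1)) - coeffT n i k) := by
    simp only [mul_neg, neg_sub_neg, mul_sum, ← sum_sub_distrib, ← sum_add_distrib, ← sum_neg_distrib]
    refine sum_congr rfl fun i hi => sum_congr rfl fun k _ => ?_
    rw [← coeff_recurrence' hn (mem_Icc.1 hi).1 k]
    ring
  rw [key, neg_eq_zero]
  have hw : ∀ i ∈ (Icc 1 4 : Finset ℕ), ∑ k ∈ range (n + 2),
      halfInvPowSum (i + 2) k * ((if k = 0 then 0 else coeffT n i (k - 1)) - coeffT n i k)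
      = ∑ k ∈ range (n + 1), coeffT n i k * ((((k : ℚ) + 1 / 2)) ^ (i + 2))⁻¹ := by
    intro i hi
    rw [sum_weight_rhs (mem_Icc.1 hi).1 _]
    refine sum_congr rfl fun k _ => ?_
    rw [halfInvPowSum_succ_sub]
    ring
  rw [sum_congr rfl fun i hi => by rw [hw i hi]]
  have h := sum_coeffT_half_eq_zero hn
  rw [sum_comm] at h
  rw [← h]
  refine sum_congr rfl fun i _ => ?_
  rw [mul_sum]
  exact sum_congr rfl fun k _ => by ring

/-! ## The bridge: the printed `ρ_{n,0}`, `ρ_{n,3}` are the recurrence-defined `rho0`, `rho3` -/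

/-- **`ρ_{n,3}` as printed = `rho3 n`** (`= 768·recSol 1 96 n` of `SecondSolution.lean`): same recursion
(Lemma 4.2 (a)), same initial values `768, 73728`. [cite: LaiSprangZudilin2026, Lemma 4.2 (a), Lemma 5.2] -/
theorem pfRho3_eq_rho3 (n : ℕ) : pfRho3 n = rho3 n := by
  suffices H : pfRho3 n = rho3 n ∧ pfRho3 (n + 1) = rho3 (n + 1) from H.1
  induction n with
  | zero =>
    refine ⟨?_, ?_⟩
    · rw [pfRho3_zero]; norm_num [rho3, rhoQ]
    · rw [pfRho3_one]; norm_num [rho3, rhoQ]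
  | succ m ih =>
    refine ⟨ih.2, ?_⟩
    have hrec := pfRho3_rec (n := m + 1) (by omega)
    rw [Nat.add_sub_cancel, ih.1, ih.2] at hrec
    rw [show m + 1 + 1 = m + 2 from rfl, rho3, rhoQ, recSol_succ_succ]
    simp only [rho3, rhoQ] at hrec
    have h2 : ((m : ℚ) + 2) ≠ 0 := by positivity
    have h2' : ((((m + 1 : ℕ) : ℚ)) + 1) ^ 5 ≠ 0 := by positivity
    field_simp
    push_cast at hrec ⊢
    linear_combination hrec

/-- **`ρ_{n,0}` as printed = `rho0 n`** (`= recSol 0 (−1024) n` of `SecondSolution.lean`): same recursion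
(Lemma 4.2 (a)), same initial values `0, −1024`. [cite: LaiSprangZudilin2026, Lemma 4.2 (a), proof of Lemma 4.2 (b)] -/
theorem pfRho0_eq_rho0 (n : ℕ) : pfRho0 n = rho0 n := by
  suffices H : pfRho0 n = rho0 n ∧ pfRho0 (n + 1) = rho0 (n + 1) from H.1
  induction n with
  | zero =>
    refine ⟨?_, ?_⟩
    · rw [pfRho0_zero]; norm_num [rho0]
    · rw [pfRho0_one]; norm_num [rho0]
  | succ m ih =>
    refine ⟨ih.2, ?_⟩
    have hrec := pfRho0_rec (n := m + 1) (by omega)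
    rw [Nat.add_sub_cancel, ih.1, ih.2] at hrec
    rw [show m + 1 + 1 = m + 2 from rfl, rho0, recSol_succ_succ]
    simp only [rho0] at hrec
    have h2 : ((m : ℚ) + 2) ≠ 0 := by positivity
    field_simp
    push_cast at hrec ⊢
    linear_combination hrec

/-- Lemma 4.2 (a) transported: the printed `ρ_{n,3}` satisfies (eq:rec) in the form of `SecondSolution.recSol_rec`.
[cite: LaiSprangZudilin2026, Lemma 4.2 (a)] -/
theorem pfRho3_eq_recSol (n : ℕ) : pfRho3 n = 768 * recSol 1 96 n := by
  rw [pfRho3_eq_rho3]; rfl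

/-- The printed `ρ_{n,0}` is the solution of (eq:rec) with `ρ_{0,0} = 0`, `ρ_{1,0} = −1024`.
[cite: LaiSprangZudilin2026, Lemma 4.2 (a), proof of Lemma 4.2 (b)] -/
theorem pfRho0_eq_recSol (n : ℕ) : pfRho0 n = recSol 0 (-1024) n := by
  rw [pfRho0_eq_rho0]; rfl

/-- **Lemma 5.2, second half, modulo its first half**: under the typed `recurrence` (the printed double sum
`lszRho` satisfies (eq:rec); discharged in the tree's `RecurrenceProofs.lean`), the printed `ρ_{n,3}` of (def_rho_3)
is `768ρ_n`: «for the coefficients `ρ_{n,3}` given in (def_rho_3) we have `ρ_{n,3} = 768ρ_n ∈ ℤ`».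
[cite: LaiSprangZudilin2026, Lemma 5.2] -/
theorem pfRho3_eq_lszRho (h : recurrence) (n : ℕ) :
    pfRho3 n = 768 * (Literature.Combinatorics.Enumerative.TwoAdicZetaFiveAperyLikeLucas.lszRho n : ℚ) := by
  rw [pfRho3_eq_rho3, rho3, rhoQ_eq_lszRho h]

end Literature.NumberTheory.Irrationality.LaiSprangZudilin2026
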